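import Mathlib
import Literature.Computability.AlgebraicComplexity.VonZurGathenSingPermHeight
import Summits.ValiantsHypothesis.ValiantsHypothesis.Theorems.ValuativeGCTValuativeFlipFourRowTransfer
import Summits.ValiantsHypothesis.ValiantsHypothesis.Theorems.ValuativeGCTValuativeFlipCyclicTangentRank

/-!
# The cyclic tridiagonal pencil certificate: `stub_fourRowPencilRank` (crux `ValuativeGCT.ValuativeFlip`)

Assembly of the cyclic-tridiagonal architecture (`Cruxes/ValuativeFlip/AxisK9G1a2CyclicTridiagonal.md`):
hypothesis `H` of `fourRowPencilRank_of_pencilCertificate` — for every `n ≥ 160` an explicit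
four-variable pencil `M(y)` whose `m`-free tangent span `span{y_t · (∂_{ij} per_n)(M(y))}` has
dimension `≥ 2⌊6n/5⌋² + ⌊6n/5⌋ + 2` — and with it the registered skeleton stub
**`stub_fourRowPencilRank`** of line `four-row-count` (VERBATIM), the per-side combinatorial heart
of the head flip.

The pencil (`cycP ν`, `ν r = r`): the cyclic tridiagonal matrix with loops `y₂ - r y₃`, clockwise
forms `y₀ - r y₁` on the cells `(r, r+1)` and counter-clockwise forms `y₀ - (r+1) y₁` on the cells
`(r, r-1)` (indices mod `n`).  Its cofactors `(∂_{ij} per_n)(M(y))` are the `cofF` of file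
`…CyclicMembershipT` (`cyc_bridge`, via vzGathen's `∂ per/∂x_{rc} = per x(r|c)`), so the span is the
tangent span `tanV`, of rank `≥ ((n-4)/2)(6n-6) ≥ 2⌊6n/5⌋² + ⌊6n/5⌋ + 2` for `n ≥ 160`
(`cyc_finrank_tanV_ge`, `cyc_count`); the four cells `(0,1), (1,2), (0,0), (1,1)` carry independent
forms (`cyc_isUnit`).

[this crux; vzGathen 1987 §2 for `∂ per = subpermanent`]
-/

set_option linter.dupNamespace false

namespace Summit.ValiantsHypothesis.ValiantsHypothesis.Theorems.ValuativeFlip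

open MvPolynomial Module
open scoped BigOperators Matrix
open Literature.NumberTheory.DiophantineGeometry
open Literature.Computability.AlgebraicComplexity

noncomputable section

section pencil

variable {n : ℕ}

/-- Coefficient vector of the loop `y₂ - s y₃`. [this crux] -/
def lvec (s : ℂ) : Fin 4 → ℂ := ![0, 0, 1, -s]

/-- Coefficient vector of the form `y₀ - s y₁`. [this crux] -/
def mvec (s : ℂ) : Fin 4 → ℂ := ![1, -s, 0, 0]

/-- The coefficient tensor of the cyclic tridiagonal pencil attached to `ν : ZMod n → ℂ`:
cell `(r,r) ↦ y₂ - ν_r y₃`, `(r,r+1) ↦ y₀ - ν_r y₁`, `(r,r-1) ↦ y₀ - ν_{r+1} y₁`. [this crux] -/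
def cycP (ν : ZMod n → ℂ) (ij : ZMod n × ZMod n) : Fin 4 → ℂ :=
  if ij.2 = ij.1 then lvec (ν ij.1) else if ij.2 = ij.1 + 1 then mvec (ν ij.1)
    else if ij.2 = ij.1 - 1 then mvec (ν (ij.1 + 1)) else 0

/-- `Σ_t (lvec s)_t y_t = y₂ - s y₃`. -/
theorem sum_lvec (s : ℂ) : ∑ t : Fin 4, lvec s t • (X t : MvPolynomial (Fin 4) ℂ) = X 2 - C s * X 3 := by
  simp [Fin.sum_univ_four, lvec, smul_eq_C_mul, sub_eq_add_neg]

/-- `Σ_t (mvec s)_t y_t = y₀ - s y₁`. -/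
theorem sum_mvec (s : ℂ) : ∑ t : Fin 4, mvec s t • (X t : MvPolynomial (Fin 4) ℂ) = X 0 - C s * X 1 := by
  simp [Fin.sum_univ_four, mvec, smul_eq_C_mul, sub_eq_add_neg]

/-- The pencil `Σ_t (cycP ν)_{ij,t} y_t` is the cyclic tridiagonal matrix of the explicit
configuration `exL ν, exM ν, exM' ν`. [this crux] -/
theorem sum_cycP (ν : ZMod n → ℂ) (i j : ZMod n) :
    ∑ t : Fin 4, cycP ν (i, j) t • (X t : MvPolynomial (Fin 4) ℂ) =
      cycM (exL ν) (exM ν) (exM' ν) i j := by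
  simp only [cycP, cycM, Matrix.of_apply, exL, exM, exM']
  split_ifs <;> simp [sum_lvec, sum_mvec]

end pencil

section bridge

/-- **The cofactors of the pencil are the `cofF`**: for `n = k+1 ≥ 3`,
`y_t · (∂_{ij} per_n)(M(y)) = y_t · cofF i j` (vzGathen: `∂ per/∂x_{ij}` is the subpermanent with
row `i` and column `j` deleted; evaluation commutes with subpermanents). [this crux] -/
theorem cyc_bridge (k : ℕ) (ν : ZMod (k + 1) → ℂ) (t : Fin 4) (i j : ZMod (k + 1)) :
    (X t : MvPolynomial (Fin 4) ℂ) *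
        aeval (fun ij : ZMod (k + 1) × ZMod (k + 1) =>
            ∑ t : Fin 4, cycP ν ij t • (X t : MvPolynomial (Fin 4) ℂ))
          (pderiv (i, j) (perPoly (ZMod (k + 1)) ℂ)) =
      X t * cofF (exL ν) (exM ν) (exM' ν) i j := by
  congr 1
  rw [VonZurGathen.pderiv_perPoly, VonZurGathen.aeval_subperm_X]
  have hmat : (Matrix.of fun r c : ZMod (k + 1) =>
      (fun ij : ZMod (k + 1) × ZMod (k + 1) =>
        ∑ t : Fin 4, cycP ν ij t • (X t : MvPolynomial (Fin 4) ℂ)) (r, c)) =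
      cycM (exL ν) (exM ν) (exM' ν) := by
    refine Matrix.ext fun r c => ?_
    rw [Matrix.of_apply]
    exact sum_cycP ν r c
  rw [hmat]
  rfl

end bridge

section cert

/-- The count: `2⌊6n/5⌋² + ⌊6n/5⌋ + 2 ≤ ((n-4)/2)(6n-6)` for `n ≥ 160`. -/
theorem cyc_count (n : ℕ) (hn : 160 ≤ n) : 2 * (6 * n / 5) ^ 2 + 6 * n / 5 + 2 ≤ (n - 4) / 2 * (6 * n - 6) := by
  obtain ⟨p, rfl⟩ : ∃ p, n = p + 5 := ⟨n - 5, by omega⟩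
  set a := 6 * (p + 5) / 5 with ha
  set s := (p + 5 - 4) / 2 with hs
  have hA : a * 5 ≤ 6 * (p + 5) := Nat.div_mul_le_self _ _
  have hS : p ≤ 2 * s := by
    have h1 := Nat.div_add_mod (p + 5 - 4) 2
    have h2 := Nat.mod_lt (p + 5 - 4) (show 0 < 2 by norm_num)
    omega
  have hB : 6 * (p + 5) - 6 = 6 * p + 24 := by omega
  rw [hB]
  have hp : 155 ≤ p := by omega
  have key : 2 * a ^ 2 + a + 2 ≤ s * (6 * p + 24) := by
    nlinarith [Nat.mul_le_mul hA hA, hA, Nat.mul_le_mul_right (6 * p + 24) hS,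
      Nat.mul_le_mul_right (3 * p + 15) hp]
  exact key

/-- **The four cells `(0,1), (1,2), (0,0), (1,1)` carry independent forms** (`n ≥ 3`): the
coefficient matrix is `[[1,1,0,0],[0,-1,0,0],[0,0,1,1],[0,0,0,-1]]`, an involution. [this crux] -/
theorem cyc_isUnit (k : ℕ) (hk : 2 ≤ k) :
    IsUnit (Matrix.of fun t t' : Fin 4 =>
      cycP (fun r : ZMod (k + 1) => ((r.val : ℕ) : ℂ))
        ((![((0 : ZMod (k + 1)), (1 : ZMod (k + 1))), (1, 2), (0, 0), (1, 1)] :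
          Fin 4 → ZMod (k + 1) × ZMod (k + 1)) t') t) := by
  haveI : Fact (1 < k + 1) := ⟨by omega⟩
  have h10 : (1 : ZMod (k + 1)) ≠ 0 := one_ne_zero_zmod (by omega)
  have hv1 : (ZMod.cast (1 : ZMod (k + 1)) : ℂ) = 1 := by
    rw [← ZMod.natCast_val, ZMod.val_one]; norm_num
  set A := Matrix.of fun t t' : Fin 4 =>
      cycP (fun r : ZMod (k + 1) => ((r.val : ℕ) : ℂ))
        ((![((0 : ZMod (k + 1)), (1 : ZMod (k + 1))), (1, 2), (0, 0), (1, 1)] :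
          Fin 4 → ZMod (k + 1) × ZMod (k + 1)) t') t with hA
  have hAe : A = !![1, 1, 0, 0; 0, -1, 0, 0; 0, 0, 1, 1; 0, 0, 0, -1] := by
    ext t t'
    rw [hA]
    fin_cases t <;> fin_cases t' <;>
      simp [cycP, lvec, mvec, h10, hv1, show (2 : ZMod (k+1)) = 1 + 1 by norm_num]
  have hsq : A * A = 1 := by
    rw [hAe]
    ext i j
    fin_cases i <;> fin_cases j <;> simp [Matrix.mul_apply, Fin.sum_univ_four]
  exact (Matrix.isUnit_iff_isUnit_det A).mpr (Matrix.isUnit_det_of_right_inverse hsq)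

/-- **Hypothesis `H` of `fourRowPencilRank_of_pencilCertificate`** — the cyclic tridiagonal pencil
certificate, `n₀ = 160`. [this crux] -/
theorem cyc_pencilCertificate :
    ∃ n₀ : ℕ, ∀ n ≥ n₀, ∃ (M : Fin n × Fin n → Fin 4 → ℂ) (c : Fin 4 → Fin n × Fin n),
      IsUnit (Matrix.of fun t t' : Fin 4 => M (c t') t) ∧
      2 * (6 * n / 5) ^ 2 + 6 * n / 5 + 2 ≤
        Module.finrank ℂ ↥(Submodule.span ℂ (Set.range fun tc : Fin 4 × (Fin n × Fin n) =>
          (X tc.1 : MvPolynomial (Fin 4) ℂ) *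
            aeval (fun ij : Fin n × Fin n => ∑ t : Fin 4, M ij t • (X t : MvPolynomial (Fin 4) ℂ))
              (pderiv tc.2 (perPoly (Fin n) ℂ)))) := by
  refine ⟨160, fun n hn => ?_⟩
  obtain ⟨k, rfl⟩ : ∃ k, n = k + 1 := ⟨n - 1, by omega⟩
  let ν : ZMod (k + 1) → ℂ := fun r => ((r.val : ℕ) : ℂ)
  have hν : Function.Injective ν := by
    intro a b h
    have h' : ((a.val : ℕ) : ℂ) = ((b.val : ℕ) : ℂ) := h
    exact ZMod.val_injective _ (by exact_mod_cast h')
  refine ⟨cycP ν,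
    (![((0 : ZMod (k + 1)), (1 : ZMod (k + 1))), (1, 2), (0, 0), (1, 1)] :
      Fin 4 → ZMod (k + 1) × ZMod (k + 1)), cyc_isUnit k (by omega), ?_⟩
  have hfam : (fun tc : Fin 4 × (Fin (k + 1) × Fin (k + 1)) => (X tc.1 : MvPolynomial (Fin 4) ℂ) *
      aeval (fun ij : Fin (k + 1) × Fin (k + 1) =>
        ∑ t : Fin 4, cycP ν ij t • (X t : MvPolynomial (Fin 4) ℂ))
        (pderiv tc.2 (perPoly (Fin (k + 1)) ℂ))) =
      fun p : Fin 4 × ZMod (k + 1) × ZMod (k + 1) => X p.1 * cofF (exL ν) (exM ν) (exM' ν) p.2.1 p.2.2 := by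
    funext tc
    exact cyc_bridge k ν tc.1 tc.2.1 tc.2.2
  rw [hfam]
  change _ ≤ finrank ℂ ↥(tanV (exL ν) (exM ν) (exM' ν))
  exact le_trans (cyc_count (k + 1) hn) (cyc_finrank_tanV_ge (K := ℂ) two_ne_zero hν hν (by omega))

/-- **`stub_fourRowPencilRank`** — the registered skeleton stub of line `four-row-count` for crux
`ValuativeGCT.ValuativeFlip` (stmt-ValiantsHypothesis-12624), VERBATIM: for all large `n` and every
`n ≤ m ≤ (6/5)·n` there is `g ∈ GL_{m²}` such that the four-row tangent span of `g · X₀₀^{m-n} per_n`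
has dimension `≥ 2m² + m + 2`.  Proof: `fourRowPencilRank_of_pencilCertificate` applied to the cyclic
tridiagonal pencil certificate `cyc_pencilCertificate`. [this crux] -/
theorem stub_fourRowPencilRank :
    ∃ n₀ : ℕ, ∀ n ≥ n₀, ∀ (m : ℕ) [NeZero m], n ≤ m → 5 * m ≤ 6 * n →
      ∃ g : GL (MatIdx m) ℂ, 2 * m ^ 2 + m + 2 ≤ Module.finrank ℂ ↥(Submodule.span ℂ (Set.range fun ab : {a : MatIdx m // m * m ≤ (((matIdxEquiv m).symm a : Fin (m * m)) : ℕ) + 4} × MatIdx m => (MvPolynomial.X ab.1.1 : MvPolynomial (MatIdx m) ℂ) * MvPolynomial.aeval (fun i : MatIdx m => if m * m ≤ (((matIdxEquiv m).symm i : Fin (m * m)) : ℕ) + 4 then (MvPolynomial.X i : MvPolynomial (MatIdx m) ℂ) else 0) (MvPolynomial.pderiv ab.2 (linSubst (MatIdx m) ℂ ((g : GL (MatIdx m) ℂ) : Matrix (MatIdx m) (MatIdx m) ℂ) (paddedPerFormLex ℂ n m))))) :=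
  fourRowPencilRank_of_pencilCertificate cyc_pencilCertificate

end cert

end

end Summit.ValiantsHypothesis.ValiantsHypothesis.Theorems.ValuativeFlip
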